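import Literature.MathematicalPhysics.QuantumFieldTheory.Balaban1983to89.B6CovTildeDecayV1
import Literature.MathematicalPhysics.QuantumFieldTheory.Balaban1983to89.B6Ineq2147TwoScaleV1B1
import Literature.MathematicalPhysics.QuantumFieldTheory.Balaban1983to89.B6Eq2143TwoScaleV1
import Literature.MathematicalPhysics.QuantumFieldTheory.Balaban1983to89.B6BlockDecayCalculus

/-!
# `Balaban1983to89.B6Ineq2148TwoScaleV1` — T. Bałaban, *Propagators and renormalization transformations for lattice gauge
# theories. II*, Commun. Math. Phys. **96** (1984) 223–250 [Balaban1984PropagatorsII], p. 249 **(2.148)**: *«This implies the same properties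
# for C^ξ_□ with the corresponding bounds and a decay rate δ₄. For the operator C_□ we get |C_□(b, b′)| ≤ O(1)(L^jη)^{−d−2}
# e^{−δ₄(L^jη)^{−1}|b₋−b′₋|}, b, b′ ∈ 𝔅 ∩ □. (2.148)»* — THE EXPONENTIAL DECAY OF THE ENTRIES OF `(QGQ*)⁻¹` AND OF EVERY COMPRESSION
# `((QGQ*)↾_S)⁻¹`, FOR THE GENUINE TWO-SCALE DATA `tsV1` (`Λ′ ⊂ T^{(j+1)}` arbitrary), uniformly in the volume, in `j`, in `Λ′` and in the
# weights of [4]'s window — by *«the theory developed in Sect. 5 of [3]»* (the finite Combes–Thomas theorem `…B4Sect5Torus.inv_decay`)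
# fed with (2.147) (`…B6Ineq2147TwoScaleV1B1.ineq2147_V1`) and the kernel decay of `QGQ*` (`…B6CovTildeDecayV1.kernel2147_decay_uniform`)

statement-level skeleton of published theorems with citation tags; proofs where landed; nothing here is a claim about the Yang–Mills mass gap

PDF held: `paper:balaban1984-cmp96-propagators-rt-ii` (journal page = PDF page + 222; pp. 248–249 [PDF 26–27] read AS IMAGES on the ×2 renders
`run/shared/lean/pub/pub-balaban/b2b-balaban-ref1/pages/1984-cmp96-propagators-rt-II/…-p026-x2.png`, `…-p027-x2.png`, 2026-08-22).

PRINT (verbatim, p. 248–249).  *"Keeping the same notations as before we consider the operators C_□ = ((QG_□Q*)↾_□)⁻¹, C = Σ_{□∈𝒟} h_□C_□h_□.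
(2.143) At first let us investigate bounds on C_□. … ⟨B, (QG_□Q*)↾_□B⟩ ≥ γ₀‖B‖² (2.147) with a positive constant γ₀ depending on d and L only.
Of course we have also a similar bound from above and an exponential decay of a kernel of the operator in (2.147). This implies the same
properties for C^ξ_□ with the corresponding bounds and a decay rate δ₄. For the operator C_□ we get |C_□(b, b′)| ≤ O(1)(L^jη)^{−d−2}
e^{−δ₄(L^jη)^{−1}|b₋−b′₋|}, b, b′ ∈ 𝔅 ∩ □. (2.148)"*; p. 250: *"Now we may apply the theory developed in Sect. 5 of [3], especially we get
the exponential decay, and all the other properties, for [the inverse]"* («[3]» = [Balaban1983RegularityDecay], Sect. 5 Theorem p. 594: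
a strictly positive symmetric operator with exponentially decaying kernel has an inverse with exponentially decaying kernel, on every
`Λ ⊂ Ω` — kernel-proved on an arbitrary finite index set with a pseudo-distance as `…B4Sect5Torus.inv_decay`/`inv_submatrix_decay`).

CITATION HEADER (lean-in-tree rule) — WHAT IS REPRODUCED.  Phase-2 file of the `lit-balaban` typed skeleton (HOME
`run/shared/lean/pub/lit-balaban/`), seat **p22 gen 17** (B6 fold owner r03, referee ref-4; lane = Sect. C on the concrete two-scale data `tsV1`).
SKELETON rows **B6.Eq2.148** (head `proved-existing`: the use-site reading `…B6Sect5Closed.ineq2148_weighted` over abstract cube data; THIS FILE =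
the MODEL INSTANCE for the genuine two-scale operator `QGQ* = Q″Q_jΔ_a⁻¹Q_j*Q″*` of `tsV1`, no displayed hypothesis left) and **B6.Prop2.7**
((2.149) read at two levels: on a two-level nested family the global `(QGQ*)⁻¹` IS the whole-torus `C_□` bounded here — cell for r03).  IMPORTS BY
NAME, nothing restated: gen 8's `…B6Eq2143TwoScaleV1.QGQs_symm`/`isUnit_QGQs_V1` (p. 248 *«QGQ* is positive, hence the inverse is well defined»*),
gen 10's `…B6Ineq2147TwoScaleV1B1.ineq2147_V1` ((2.147) `γ₀‖x‖² ≤ ⟨x, QGQ*x⟩`), gen 12's `…B6CovTildeDecayV1.kernel2147_decay_uniform` (*«an exponential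
decay of a kernel of the operator in (2.147)»*), pv09's `…B4Sect5Torus.inv_decay`/`inv_submatrix_decay`/`IsPseudoDist`/`SumBound`/`Hyp56`/`rate`
([3] Sect. 5 on a finite index set), gen 14's `…B6BlockDecayCalculus.torusDist_isPseudoDist`, gen 11's site-matrix dictionary `…B6Cov2110MatrixV1.siteMatrix_*` and torus metric `…B6Cov2110WeightV1.torusSupNorm_*`,
p03/p38's uniform torus sum `…B5Hk163TorusHolderRate.sum_exp_torusSupNorm_sub_rep_le`.

THIS FILE (positions of the indices `i ∈ 𝔅 = Λ^c ⊔ Λ′` as in gen 12: `p(o) = x_{o₋}` for a `Λ^c`-bond `o`, `p(c) = x̂(c₋)` the anchor of the block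
`B(c₋)` for a `Λ′`-bond `c`; `ρ(i, i′) = |p(i) − p(i′)|_T` the torus sup-distance of `T^{(j)}`; `κ = c²/(η^{d+1}L^{2j})` the V1 normalisation):
* §1 (generic `ℓ²(ι)`): **`siteMatrix_inverse`** (the site matrix of `Ring.inverse T` is the inverse of the site matrix of a unit `T`),
  **`inner_single_inverse_single`** (`⟨e_x, T⁻¹e_{x′}⟩ = (M_T)⁻¹(x, x′)`), **`hyp56_siteMatrix`** ([3] (5.6) for the NORMALISED site matrix `c₀⁻¹M_T` from an
  operator lower bound `γ₀` and an entry bound `c₀e^{−δ₀ρ}`), **`inverse_entry_decay`** / **`inverse_submatrix_entry_decay`** — [3] Sect. 5 (5.7) AT OPERATOR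
  LEVEL: `|⟨e_x, T⁻¹e_{x′}⟩| ≤ (2/γ₀)·e^{−δ₁ρ(x,x′)}` and the same for every compression `(M_T↾_S)⁻¹`, with `δ₁ = rate_K(γ₀/c₀, 1, δ₀)` SCALE-FREE (a
  function of the RATIO `γ₀/c₀`, of `δ₀` and of the lattice-sum profile `K` only);
* §2 (the index set `𝔅` of `tsV1`, placed over the unit torus `T^{(j)}` by the SITE MAP `i ↦ site(i)` — `o₋` for a `Λ^c`-bond `o`, the block anchor
  `x̂(c₋)` for a `Λ′`-bond `c` —, so that `ρ` is gen 14's torus pseudo-distance `…B6BlockDecayCalculus.torusDist_isPseudoDist` pulled back):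
  **`rho_isPseudoDist`**, `pos_eq` (the position `rep(site i)` IS gen 12's `p(i)`), **`rho_sumBound`** (`Σ_{i′} e^{−aρ(i,i′)} ≤ 2(d+1)·K_{d+1}(a)`: at
  most `d + 1` indices of each kind per site, sites injective images of torus sites, `sum_exp_torusSupNorm_sub_rep_le`);
* §3 **`ineq2148_V1_of_kernel`** ((2.148) for `tsV1` from a displayed kernel bound of `QGQ*`, any `c ≠ 0`, weights `0 < w ≤ W`) and
  **`ineq2148_V1_uniform`**: for every `d + 1`, odd `L > 1`, `0 < a₀ ≤ a₁` THERE IS `δ₄ > 0` such that for every volume `(m, K)`, `c ≠ 0`, `j + 1 ≤ m + K`,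
  `Λ′ ⊂ T^{(j+1)}`, weights `a₀κ ≤ w ≤ a₁κ` and all `i, i′ ∈ 𝔅`:
  `|⟨e_i, (QGQ*)⁻¹e_{i′}⟩| ≤ 2κ·(a₁(1 + L^{−(d+1)}) + 8(d+1)γ₁)(2 + 4L² + L^{d+3})·e^{−δ₄ρ(i,i′)}` — and **`ineq2148_V1_submatrix_uniform`**, the same bound
  with the same `δ₄` for the inverse of EVERY compression `(QGQ*)↾_S` along an injection `S ↪ 𝔅` (print's `C_□ = ((QG_□Q*)↾_□)⁻¹`, *"We put B equal to
  0 outside □"*).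
THEOREMS ONLY (no definition, no `def … : Prop` fact); standard axioms.  HONEST SCOPE: entry bounds in the orthonormal basis `{e_i}` of `L²(𝔅)` of the
finite V1 model (`L` odd, centred blocks); positions/distances ours (`T^{(j)}` sup-metric; print: `(L^jη)^{−1}|b₋ − b′₋|`); the rate `δ₄` depends on
`d, L` and the weight RATIOS `a₀, a₁` (print: *"d and L only"* at `a = 1`); the prefactor `2/γ₀` carries the V1 normalisation `κ` (print's
`(L^jη)^{−d−2}` at the unit normalisation, cf. gen 10's `ineq2147_V1_printed`); `□` = any index subset (print: a cube); NOT summit progress.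
Unit `lit-balaban-p22` (gen 17), 2026-08-22.
-/

noncomputable section

open scoped InnerProductSpace
open Finset Matrix

namespace Literature.MathematicalPhysics.QuantumFieldTheory.Balaban1983to89.B6Ineq2148TwoScaleV1

open LatticeFieldCalculus B6SectAOperatorsV1 B6SectCTwoScaleV1 B6SectCTwoScaleV1Lattice
open B6SectCOperators (TwoScaleData)
open B5SectBStatements (eta)
open B4Sect5Proof (latticeConst latticeConst_nonneg)
open B4Sect5Torus (IsPseudoDist SumBound Hyp56 rate rate_pos inv_decay inv_submatrix_decay)
open B4TorusKernel.MultiPeriod (torusSupNorm torusSupNorm_nonneg)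
open B5Eq117TorusCarriers (Mk)
open B6LowerBound2153Torus (rep)
open B6Cov2156Torus (one_le_M)
open B5Hk163TorusHolderRate (sum_exp_torusSupNorm_sub_rep_le)
open B6Cov2110MatrixV1 (siteMatrix_mulVec dotProduct_siteMatrix_mulVec siteMatrix_apply_eq_inner siteMatrix_isSymm_of_symm siteMatrix_mul)
open B6Cov2110WeightV1 (torusSupNorm_neg torusSupNorm_zero torusSupNorm_sub_le)
open B6BlockDecayCalculus (torusDist_isPseudoDist)
open B6Eq2143TwoScaleV1 (QGQs QGQs_symm isUnit_QGQs_V1)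
open B6Ineq2147TwoScaleV1B1 (ineq2147_V1)
open B6CovTildeDecayV1 (kernel2147_decay_uniform)
open Beta.Ineq167OperatorUpper (gamma1)

/-! ## §0  Local notation (hygiene off: `d L m K hd hL j Λ'` are resolved at each use site, as in gen 11's `…B6Cov2110DecayV1`) -/

set_option hygiene false in
/-- the period vector of the unit torus `T^{(j)}` of the parameter set `(d + 1, L, m, K)`. -/
local notation "M₀" => Mk (⟨d + 1, L, m, K, hd, hL⟩ : Params) j

set_option hygiene false in
/-- the SITE of an index of `𝔅 = Λ^c ⊔ Λ′` (gen 12's positions): `o₋` for a `Λ^c`-bond `o`, the anchor `x̂(c₋)` of the block `B(c₋)` for a `Λ′`-bond `c`;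
its representative `rep M₀ (site₀ i)` is gen 12's position `p(i)`. -/
local notation "site₀" => (Sum.elim (fun o : OutBond j Λ' => o.1.src)
  (fun b₁ : InBond j Λ' => Site.blockSite b₁.1.src (fun _ => ⟨0, Params.L_pos _⟩)) :
    CIdx j Λ' → Site (⟨d + 1, L, m, K, hd, hL⟩ : Params) j)

set_option hygiene false in
/-- the position `p(i) = rep(site i)` of an index. -/
local notation "pos₀" => (fun i : CIdx j Λ' => rep (Mk (⟨d + 1, L, m, K, hd, hL⟩ : Params) j) (site₀ i))

/-! ## §1  [3] Sect. 5 (5.7) at operator level on `ℓ²(ι)`: the entries of the inverse of a strictly positive operator with decaying entries -/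

section Generic

variable {ι : Type*} [Fintype ι] [DecidableEq ι] (T : EuclideanSpace ℝ ι →ₗ[ℝ] EuclideanSpace ℝ ι)

omit [Fintype ι] in
/-- the site matrix of the identity is `1`. [folklore] -/
private theorem siteMatrix_id :
    Matrix.of (fun x x' : ι => (LinearMap.id : EuclideanSpace ℝ ι →ₗ[ℝ] EuclideanSpace ℝ ι) (EuclideanSpace.single x' (1 : ℝ)) x) = 1 := by
  ext x x'
  simp [Matrix.one_apply]

/-- **the site matrix of `Ring.inverse T` is the inverse of the site matrix of a unit `T`** (`M_{T⁻¹}M_T = M_{T⁻¹T} = 1`).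
[cite: Balaban1983RegularityDecay, Sect. 5 Theorem p.594] -/
theorem siteMatrix_inverse (hT : IsUnit T) :
    Matrix.of (fun x x' : ι => (Ring.inverse T) (EuclideanSpace.single x' (1 : ℝ)) x) =
      (Matrix.of (fun x x' : ι => T (EuclideanSpace.single x' (1 : ℝ)) x))⁻¹ := by
  symm
  apply Matrix.inv_eq_left_inv
  rw [siteMatrix_mul]
  have h : Ring.inverse T ∘ₗ T = LinearMap.id := by
    have h1 := Ring.inverse_mul_cancel T hT
    rwa [Module.End.mul_eq_comp, Module.End.one_eq_id] at h1
  rw [h]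
  exact siteMatrix_id

/-- the entries of the inverse: `⟨e_x, T⁻¹e_{x′}⟩ = (M_T)⁻¹(x, x′)`. [cite: Balaban1983RegularityDecay, Sect. 5 Theorem p.594] -/
theorem inner_single_inverse_single (hT : IsUnit T) (x x' : ι) :
    ⟪EuclideanSpace.single x (1 : ℝ), (Ring.inverse T) (EuclideanSpace.single x' (1 : ℝ))⟫_ℝ =
      (Matrix.of (fun x x' : ι => T (EuclideanSpace.single x' (1 : ℝ)) x))⁻¹ x x' := by
  rw [← siteMatrix_inverse T hT, siteMatrix_apply_eq_inner]

/-- **[3] (5.6) for the NORMALISED site matrix `c₀⁻¹M_T`**: an operator lower bound `γ₀‖x‖² ≤ ⟨x, Tx⟩`, symmetry and an entry bound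
`|⟨e_x, Te_{x′}⟩| ≤ c₀e^{−δ₀ρ(x,x′)}` (`c₀ > 0`) give `Hyp56 ρ (c₀⁻¹M_T) (γ₀/c₀) 1 δ₀`. [cite: Balaban1983RegularityDecay, (5.6) p.594] -/
theorem hyp56_siteMatrix (hsymm : ∀ a b : EuclideanSpace ℝ ι, ⟪T a, b⟫_ℝ = ⟪a, T b⟫_ℝ) {γ₀ c₀ δ₀ : ℝ} (hc₀ : 0 < c₀)
    (hlow : ∀ x : EuclideanSpace ℝ ι, γ₀ * ‖x‖ ^ 2 ≤ ⟪x, T x⟫_ℝ) (ρ : ι → ι → ℝ)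
    (hent : ∀ x x' : ι, |⟪EuclideanSpace.single x (1 : ℝ), T (EuclideanSpace.single x' (1 : ℝ))⟫_ℝ| ≤ c₀ * Real.exp (-(δ₀ * ρ x x'))) :
    Hyp56 ρ (c₀⁻¹ • Matrix.of (fun x x' : ι => T (EuclideanSpace.single x' (1 : ℝ)) x)) (γ₀ / c₀) 1 δ₀ := by
  refine ⟨(siteMatrix_isSymm_of_symm T hsymm).smul c₀⁻¹, fun v => ?_, fun x x' => ?_⟩
  · have h1 : ∑ p, v p * ((c₀⁻¹ • Matrix.of (fun x x' : ι => T (EuclideanSpace.single x' (1 : ℝ)) x)) *ᵥ v) p =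
        c₀⁻¹ * ⟪WithLp.toLp 2 v, T (WithLp.toLp 2 v)⟫_ℝ := by
      rw [Matrix.smul_mulVec]
      show v ⬝ᵥ (c₀⁻¹ • (Matrix.of (fun x x' : ι => T (EuclideanSpace.single x' (1 : ℝ)) x) *ᵥ v)) = _
      rw [dotProduct_smul, smul_eq_mul, dotProduct_siteMatrix_mulVec]
    have h2 : ∑ p, v p ^ 2 = ‖WithLp.toLp 2 v‖ ^ 2 := by
      rw [EuclideanSpace.norm_eq, Real.sq_sqrt (Finset.sum_nonneg fun i _ => by positivity)]
      exact Finset.sum_congr rfl fun i _ => by rw [PiLp.toLp_apply, Real.norm_eq_abs, sq_abs]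
    rw [h1, h2, div_eq_mul_inv, mul_comm γ₀, mul_assoc]
    exact mul_le_mul_of_nonneg_left (hlow _) (inv_nonneg.mpr hc₀.le)
  · rw [Matrix.smul_apply, smul_eq_mul, siteMatrix_apply_eq_inner, abs_mul, abs_of_pos (inv_pos.mpr hc₀), one_mul]
    have h := hent x x'
    calc c₀⁻¹ * |⟪EuclideanSpace.single x (1 : ℝ), T (EuclideanSpace.single x' (1 : ℝ))⟫_ℝ| ≤ c₀⁻¹ * (c₀ * Real.exp (-(δ₀ * ρ x x'))) :=
          mul_le_mul_of_nonneg_left h (inv_nonneg.mpr hc₀.le)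
      _ = Real.exp (-(δ₀ * ρ x x')) := by rw [← mul_assoc, inv_mul_cancel₀ hc₀.ne', one_mul]

/-- **[3] Sect. 5 (5.7) AT OPERATOR LEVEL**: a symmetric `T` on `ℓ²(ι)` with `γ₀‖x‖² ≤ ⟨x, Tx⟩` (`γ₀ > 0`) and `|⟨e_x, Te_{x′}⟩| ≤ c₀e^{−δ₀ρ(x,x′)}`
(`c₀, δ₀ > 0`) for a pseudo-distance `ρ` with lattice-sum profile `K` is a unit, and `|⟨e_x, T⁻¹e_{x′}⟩| ≤ (2/γ₀)·e^{−δ₁ρ(x,x′)}` with the SCALE-FREE rate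
`δ₁ = rate_K(γ₀/c₀, 1, δ₀)` (applied to the normalised matrix `c₀⁻¹M_T`, whose inverse is `c₀M_T⁻¹`). [cite: Balaban1983RegularityDecay, Sect. 5 Theorem (5.7) p.594] -/
theorem inverse_entry_decay (hsymm : ∀ a b : EuclideanSpace ℝ ι, ⟪T a, b⟫_ℝ = ⟪a, T b⟫_ℝ) {γ₀ c₀ δ₀ : ℝ} (hγ₀ : 0 < γ₀) (hc₀ : 0 < c₀)
    (hδ₀ : 0 < δ₀) (hlow : ∀ x : EuclideanSpace ℝ ι, γ₀ * ‖x‖ ^ 2 ≤ ⟪x, T x⟫_ℝ) {ρ : ι → ι → ℝ} (hρ : IsPseudoDist ρ) {K : ℝ → ℝ}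
    (hK : ∀ a, 0 < a → 0 ≤ K a) (hS : SumBound ρ K)
    (hent : ∀ x x' : ι, |⟪EuclideanSpace.single x (1 : ℝ), T (EuclideanSpace.single x' (1 : ℝ))⟫_ℝ| ≤ c₀ * Real.exp (-(δ₀ * ρ x x')))
    (hT : IsUnit T) (x x' : ι) :
    |⟪EuclideanSpace.single x (1 : ℝ), (Ring.inverse T) (EuclideanSpace.single x' (1 : ℝ))⟫_ℝ| ≤
      2 / γ₀ * Real.exp (-(rate K (γ₀ / c₀) 1 δ₀ * ρ x x')) := by
  set M := Matrix.of (fun x x' : ι => T (EuclideanSpace.single x' (1 : ℝ)) x) with hM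
  have h56 := hyp56_siteMatrix T hsymm hc₀ hlow ρ hent
  have hinv := inv_decay hK (div_pos hγ₀ hc₀) zero_le_one hδ₀ hρ hS h56 x x'
  -- `(c₀⁻¹M)⁻¹ = c₀M⁻¹`
  have hu : IsUnit (c₀⁻¹ • M) := B4Sect5Torus.isUnit_of_hyp56 (div_pos hγ₀ hc₀) h56
  have hMu : IsUnit M.det := by
    have h1 : IsUnit ((c₀⁻¹ • M).det) := (Matrix.isUnit_iff_isUnit_det _).mp hu
    rw [Matrix.det_smul] at h1
    exact isUnit_of_mul_isUnit_right h1
  have hsmul : (c₀⁻¹ • M)⁻¹ = c₀ • M⁻¹ := by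
    apply Matrix.inv_eq_left_inv
    rw [Matrix.smul_mul, Matrix.mul_smul, smul_smul, Matrix.nonsing_inv_mul _ hMu, mul_inv_cancel₀ hc₀.ne', one_smul]
  rw [inner_single_inverse_single T hT, ← hM]
  rw [hsmul, Matrix.smul_apply, smul_eq_mul, abs_mul, abs_of_pos hc₀] at hinv
  have hc : |M⁻¹ x x'| ≤ c₀⁻¹ * (2 / (γ₀ / c₀) * Real.exp (-(rate K (γ₀ / c₀) 1 δ₀ * ρ x x'))) := by
    rw [← div_eq_inv_mul, le_div_iff₀ hc₀, mul_comm]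
    exact hinv
  refine hc.trans (le_of_eq ?_)
  field_simp

/-- **[3] Sect. 5 (5.7) for every COMPRESSION along an injection** `e : ι′ ↪ ι` (print's `C_Λ = A_Λ⁻¹`, `A_Λ = ΛAΛ`; here the inverse of the
compressed site matrix `M_T↾_{range e}`), SAME constants. [cite: Balaban1983RegularityDecay, Sect. 5 Theorem (5.7) p.594] -/
theorem inverse_submatrix_entry_decay (hsymm : ∀ a b : EuclideanSpace ℝ ι, ⟪T a, b⟫_ℝ = ⟪a, T b⟫_ℝ) {γ₀ c₀ δ₀ : ℝ} (hγ₀ : 0 < γ₀)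
    (hc₀ : 0 < c₀) (hδ₀ : 0 < δ₀) (hlow : ∀ x : EuclideanSpace ℝ ι, γ₀ * ‖x‖ ^ 2 ≤ ⟪x, T x⟫_ℝ) {ρ : ι → ι → ℝ} (hρ : IsPseudoDist ρ)
    {K : ℝ → ℝ} (hK : ∀ a, 0 < a → 0 ≤ K a) (hS : SumBound ρ K)
    (hent : ∀ x x' : ι, |⟪EuclideanSpace.single x (1 : ℝ), T (EuclideanSpace.single x' (1 : ℝ))⟫_ℝ| ≤ c₀ * Real.exp (-(δ₀ * ρ x x')))
    {ι' : Type*} [Fintype ι'] [DecidableEq ι'] {e : ι' → ι} (he : Function.Injective e) (y y' : ι') :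
    |((Matrix.of (fun x x' : ι => T (EuclideanSpace.single x' (1 : ℝ)) x)).submatrix e e)⁻¹ y y'| ≤
      2 / γ₀ * Real.exp (-(rate K (γ₀ / c₀) 1 δ₀ * ρ (e y) (e y'))) := by
  set M := Matrix.of (fun x x' : ι => T (EuclideanSpace.single x' (1 : ℝ)) x) with hM
  have h56 := hyp56_siteMatrix T hsymm hc₀ hlow ρ hent
  have hinv := inv_submatrix_decay hK (div_pos hγ₀ hc₀) zero_le_one hδ₀ hρ hS h56 he y y'
  -- the compressed normalised matrix is `c₀⁻¹ • M.submatrix e e`, strictly positive hence a unit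
  have hsub : (c₀⁻¹ • M).submatrix e e = c₀⁻¹ • M.submatrix e e := rfl
  rw [hsub] at hinv
  have h56' := B4Sect5Torus.hyp56_submatrix h56 he
  rw [hsub] at h56'
  have hγc : 0 < γ₀ / c₀ := div_pos hγ₀ hc₀
  have hu : IsUnit (c₀⁻¹ • M.submatrix e e) := B4Sect5Torus.isUnit_of_hyp56 hγc h56'
  have hMu : IsUnit (M.submatrix e e).det := by
    have h1 : IsUnit ((c₀⁻¹ • M.submatrix e e).det) := (Matrix.isUnit_iff_isUnit_det _).mp hu
    rw [Matrix.det_smul] at h1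
    exact isUnit_of_mul_isUnit_right h1
  have hsmul : (c₀⁻¹ • M.submatrix e e)⁻¹ = c₀ • (M.submatrix e e)⁻¹ := by
    apply Matrix.inv_eq_left_inv
    rw [Matrix.smul_mul, Matrix.mul_smul, smul_smul, Matrix.nonsing_inv_mul _ hMu, mul_inv_cancel₀ hc₀.ne', one_smul]
  rw [hsmul, Matrix.smul_apply, smul_eq_mul, abs_mul, abs_of_pos hc₀] at hinv
  have hc : |(M.submatrix e e)⁻¹ y y'| ≤ c₀⁻¹ * (2 / (γ₀ / c₀) * Real.exp (-(rate K (γ₀ / c₀) 1 δ₀ * ρ (e y) (e y')))) := by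
    rw [← div_eq_inv_mul, le_div_iff₀ hc₀, mul_comm]
    exact hinv
  refine hc.trans (le_of_eq ?_)
  field_simp

end Generic

/-! ## §2  The index set `𝔅 = Λ^c ⊔ Λ′` of `tsV1`: the position pseudo-distance and its lattice-sum profile -/

section Index

/-! The torus sup-metric `torusSupNorm` is written with the dimension as `d + 1`; accordingly the parameter set is written here as
`⟨d + 1, L, m, K, _, _⟩` — EVERY `P : Params` is of this form (`P.hd : 1 ≤ P.d`). -/

variable {d L m K : ℕ} {hd : 1 ≤ d + 1} {hL : Odd L ∧ 1 < L} {j : ℕ}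
  (Λ' : Finset (Site (⟨d + 1, L, m, K, hd, hL⟩ : Params) (j + 1)))

/-- a sub-sum of nonnegative terms over a subtype is at most the full sum. [folklore] -/
private theorem sum_subtype_le {α : Type*} [Fintype α] (p : α → Prop) [DecidablePred p] (f : α → ℝ) (hf : ∀ a, 0 ≤ f a) :
    ∑ a : {a // p a}, f a.1 ≤ ∑ a, f a := by
  calc ∑ a : {a // p a}, f a.1 = ∑ a ∈ (Finset.univ : Finset {a // p a}).map (Function.Embedding.subtype p), f a := by
        rw [Finset.sum_map]; rfl
    _ ≤ ∑ a, f a := Finset.sum_le_univ_sum_of_nonneg hf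

/-- a sum over bonds of a function of the source is `(d + 1)` times the sum over sites. [folklore] -/
private theorem sum_bond_src (g : Site (⟨d + 1, L, m, K, hd, hL⟩ : Params) j → ℝ) :
    ∑ b : PBond (⟨d + 1, L, m, K, hd, hL⟩ : Params) j, g b.src = ((d : ℝ) + 1) * ∑ x, g x := by
  calc ∑ b : PBond (⟨d + 1, L, m, K, hd, hL⟩ : Params) j, g b.src
      = ∑ q : Site (⟨d + 1, L, m, K, hd, hL⟩ : Params) j × Fin (d + 1), g (bondEquiv q).src :=
        (Equiv.sum_comp (bondEquiv (P := ⟨d + 1, L, m, K, hd, hL⟩) (j := j)) (fun b => g b.src)).symm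
    _ = ∑ x : Site (⟨d + 1, L, m, K, hd, hL⟩ : Params) j, ∑ _μ : Fin (d + 1), g x := by
        rw [Fintype.sum_prod_type]; rfl
    _ = ((d : ℝ) + 1) * ∑ x, g x := by
        rw [Finset.mul_sum]
        refine Finset.sum_congr rfl fun x _ => ?_
        rw [Finset.sum_const, Finset.card_univ, Fintype.card_fin, nsmul_eq_mul]
        push_cast; ring

/-- a sum over the coarse sites of a nonnegative function of the block anchor is at most the sum over all fine sites (the anchor map is injective).
[folklore] -/
private theorem sum_anchor_le (hj : j + 1 ≤ m + K) (g : Site (⟨d + 1, L, m, K, hd, hL⟩ : Params) j → ℝ) (hg : ∀ x, 0 ≤ g x) :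
    ∑ y : Site (⟨d + 1, L, m, K, hd, hL⟩ : Params) (j + 1), g (Site.blockSite y (fun _ => ⟨0, Params.L_pos _⟩)) ≤ ∑ x, g x := by
  have hinj : Function.Injective (fun y : Site (⟨d + 1, L, m, K, hd, hL⟩ : Params) (j + 1) => Site.blockSite y (fun _ => ⟨0, Params.L_pos _⟩)) :=
    fun y y' h => by
      have h1 := congrArg blockOf h
      simp only [Site.blockOf_blockSite (P := ⟨d + 1, L, m, K, hd, hL⟩) hj] at h1
      exact h1
  calc ∑ y : Site (⟨d + 1, L, m, K, hd, hL⟩ : Params) (j + 1), g (Site.blockSite y (fun _ => ⟨0, Params.L_pos _⟩))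
      = ∑ x ∈ (Finset.univ : Finset (Site (⟨d + 1, L, m, K, hd, hL⟩ : Params) (j + 1))).map ⟨_, hinj⟩, g x := by
        rw [Finset.sum_map]; rfl
    _ ≤ ∑ x, g x := Finset.sum_le_univ_sum_of_nonneg hg

/-- **the position pseudo-distance** `ρ(i, i′) = |p(i) − p(i′)|_T` on `𝔅` (symmetric, zero on the diagonal, triangle inequality).
[cite: Balaban1984PropagatorsII, (2.148) p.249] -/
theorem rho_isPseudoDist : IsPseudoDist (fun i i' : CIdx j Λ' =>
    torusSupNorm M₀ (pos₀ i - pos₀ i')) :=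
  (torusDist_isPseudoDist (Mk (⟨d + 1, L, m, K, hd, hL⟩ : Params) j)).comp _

/-- the position of an index, spelled as in gen 12's `kernel2147_decay_uniform`. [cite: Balaban1984PropagatorsII, (2.148) p.249] -/
theorem pos_eq (i : CIdx j Λ') : pos₀ i = Sum.elim (fun o : OutBond j Λ' => rep M₀ o.1.src)
    (fun b₁ : InBond j Λ' => rep M₀ (Site.blockSite b₁.1.src (fun _ => ⟨0, Params.L_pos _⟩))) i := by
  cases i <;> rfl

/-- **the lattice-sum profile of `𝔅`**: `Σ_{i′∈𝔅} e^{−aρ(i,i′)} ≤ 2(d+1)·K_{d+1}(a)` — each kind of index has at most `d + 1` members per position, the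
positions run injectively over torus sites, and `Σ_t e^{−a|y − t|_T} ≤ K_{d+1}(a)` uniformly. [cite: Balaban1984PropagatorsII, (2.148) p.249] -/
theorem rho_sumBound (hj : j + 1 ≤ m + K) : SumBound (fun i i' : CIdx j Λ' =>
    torusSupNorm M₀ (pos₀ i - pos₀ i'))
    (fun a => 2 * ((d : ℝ) + 1) * latticeConst (d + 1) a) := by
  intro a ha i
  set M := Mk (⟨d + 1, L, m, K, hd, hL⟩ : Params) j with hM
  set y : Fin (d + 1) → ℤ := rep M (site₀ i) with hy
  rw [Fintype.sum_sum_type]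
  simp only [Sum.elim_inl, Sum.elim_inr]
  have hK := sum_exp_torusSupNorm_sub_rep_le M ha y
  have h1 : ∑ o : OutBond j Λ', Real.exp (-(a * torusSupNorm M (y - rep M o.1.src))) ≤ ((d : ℝ) + 1) * latticeConst (d + 1) a := by
    calc ∑ o : OutBond j Λ', Real.exp (-(a * torusSupNorm M (y - rep M o.1.src)))
        ≤ ∑ b : PBond (⟨d + 1, L, m, K, hd, hL⟩ : Params) j, Real.exp (-(a * torusSupNorm M (y - rep M b.src))) :=
          sum_subtype_le _ (fun b : PBond (⟨d + 1, L, m, K, hd, hL⟩ : Params) j => Real.exp (-(a * torusSupNorm M (y - rep M b.src))))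
            (fun _ => (Real.exp_pos _).le)
      _ = ((d : ℝ) + 1) * ∑ x, Real.exp (-(a * torusSupNorm M (y - rep M x))) :=
          sum_bond_src (fun x => Real.exp (-(a * torusSupNorm M (y - rep M x))))
      _ ≤ ((d : ℝ) + 1) * latticeConst (d + 1) a := mul_le_mul_of_nonneg_left hK (by positivity)
  have h2 : ∑ e : InBond j Λ', Real.exp (-(a * torusSupNorm M (y - rep M (Site.blockSite e.1.src (fun _ => ⟨0, Params.L_pos _⟩))))) ≤
      ((d : ℝ) + 1) * latticeConst (d + 1) a := by
    calc ∑ e : InBond j Λ', Real.exp (-(a * torusSupNorm M (y - rep M (Site.blockSite e.1.src (fun _ => ⟨0, Params.L_pos _⟩)))))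
        ≤ ∑ b : PBond (⟨d + 1, L, m, K, hd, hL⟩ : Params) (j + 1),
            Real.exp (-(a * torusSupNorm M (y - rep M (Site.blockSite b.src (fun _ => ⟨0, Params.L_pos _⟩))))) :=
          sum_subtype_le _ (fun b : PBond (⟨d + 1, L, m, K, hd, hL⟩ : Params) (j + 1) =>
            Real.exp (-(a * torusSupNorm M (y - rep M (Site.blockSite b.src (fun _ => ⟨0, Params.L_pos _⟩)))))) (fun _ => (Real.exp_pos _).le)
      _ = ((d : ℝ) + 1) * ∑ Y : Site (⟨d + 1, L, m, K, hd, hL⟩ : Params) (j + 1),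
            Real.exp (-(a * torusSupNorm M (y - rep M (Site.blockSite Y (fun _ => ⟨0, Params.L_pos _⟩))))) :=
          sum_bond_src (fun Y : Site (⟨d + 1, L, m, K, hd, hL⟩ : Params) (j + 1) =>
            Real.exp (-(a * torusSupNorm M (y - rep M (Site.blockSite Y (fun _ => ⟨0, Params.L_pos _⟩))))))
      _ ≤ ((d : ℝ) + 1) * ∑ x, Real.exp (-(a * torusSupNorm M (y - rep M x))) :=
          mul_le_mul_of_nonneg_left (sum_anchor_le hj (fun x => Real.exp (-(a * torusSupNorm M (y - rep M x))))
            (fun _ => (Real.exp_pos _).le)) (by positivity)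
      _ ≤ ((d : ℝ) + 1) * latticeConst (d + 1) a := mul_le_mul_of_nonneg_left hK (by positivity)
  linarith

end Index

/-! ## §3  (2.148) for the genuine two-scale `QGQ*` of `tsV1` -/

section TwoScale

variable {d L m K : ℕ} {hd : 1 ≤ d + 1} {hL : Odd L ∧ 1 < L} {c : ℝ} (hc : c ≠ 0) {j : ℕ}
  (Λ' : Finset (Site (⟨d + 1, L, m, K, hd, hL⟩ : Params) (j + 1))) {w : CIdx j Λ' → ℝ} (hw : ∀ i, 0 < w i)
  [DecidableEq (CIdx j Λ')]

include hw in
/-- **(2.148) FOR `tsV1` FROM A DISPLAYED KERNEL BOUND**: if `|⟨e_i, QGQ*e_{i′}⟩| ≤ c₀e^{−δ₀ρ(i,i′)}` (`c₀, δ₀ > 0`) and the weights satisfy `0 < w ≤ W`,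
then with (2.147)'s `γ₀ = (W(1 + L^{−(d+1)}) + 8(d+1)γ₁κ)⁻¹(2 + 4L² + L^{d+3})⁻¹`:
`|⟨e_i, (QGQ*)⁻¹e_{i′}⟩| ≤ (2/γ₀)·e^{−δ₁ρ(i,i′)}`, `δ₁ = rate_{2(d+1)K_{d+1}}(γ₀/c₀, 1, δ₀)` — [3] Sect. 5 (§1) on the index set `𝔅` (§2).
[cite: Balaban1984PropagatorsII, (2.148) p.249] -/
theorem ineq2148_V1_of_kernel (hj : j + 1 ≤ m + K) {W : ℝ} (hW0 : 0 ≤ W) (hW : ∀ i, w i ≤ W) {c₀ δ₀ : ℝ} (hc₀ : 0 < c₀) (hδ₀ : 0 < δ₀)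
    (hker : ∀ i i' : CIdx j Λ',
      |⟪EuclideanSpace.single i (1 : ℝ), (tsV1 hc Λ' w).Q ((tsV1 hc Λ' w).G (LinearMap.adjoint (tsV1 hc Λ' w).Q (EuclideanSpace.single i' (1 : ℝ))))⟫_ℝ| ≤
        c₀ * Real.exp (-(δ₀ * torusSupNorm M₀ (pos₀ i - pos₀ i'))))
    (i i' : CIdx j Λ') :
    |⟪EuclideanSpace.single i (1 : ℝ), Ring.inverse (QGQs hc Λ' (w := w)) (EuclideanSpace.single i' (1 : ℝ))⟫_ℝ| ≤
      2 / ((W * (1 + ((L : ℝ) ^ (d + 1))⁻¹) + c ^ 2 / (eta L j ^ (d + 1) * ((L : ℝ) ^ j) ^ 2) * (gamma1 (d + 1) * (8 * (d + 1 : ℕ))))⁻¹ *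
          (2 + 4 * (L : ℝ) ^ 2 + (L : ℝ) ^ (d + 1 + 2))⁻¹) *
        Real.exp (-(rate (fun a => 2 * ((d : ℝ) + 1) * latticeConst (d + 1) a)
          (((W * (1 + ((L : ℝ) ^ (d + 1))⁻¹) + c ^ 2 / (eta L j ^ (d + 1) * ((L : ℝ) ^ j) ^ 2) * (gamma1 (d + 1) * (8 * (d + 1 : ℕ))))⁻¹ *
            (2 + 4 * (L : ℝ) ^ 2 + (L : ℝ) ^ (d + 1 + 2))⁻¹) / c₀) 1 δ₀ *
          torusSupNorm M₀ (pos₀ i - pos₀ i'))) := by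
  have hjP : j + 1 ≤ (⟨d + 1, L, m, K, hd, hL⟩ : Params).m + (⟨d + 1, L, m, K, hd, hL⟩ : Params).K := hj
  have hκ : 0 < c ^ 2 / (eta L j ^ (d + 1) * ((L : ℝ) ^ j) ^ 2) :=
    B6Ineq2118TwoScaleV1.kappa_pos (P := (⟨d + 1, L, m, K, hd, hL⟩ : Params)) hc (j := j)
  have hγ1 : 0 < gamma1 (d + 1) := Beta.Ineq167OperatorUpper.gamma1_pos (d + 1)
  have hLpos : (0 : ℝ) < L := by exact_mod_cast (lt_trans Nat.zero_lt_one hL.2)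
  have hγ₀ : 0 < (W * (1 + ((L : ℝ) ^ (d + 1))⁻¹) + c ^ 2 / (eta L j ^ (d + 1) * ((L : ℝ) ^ j) ^ 2) * (gamma1 (d + 1) * (8 * (d + 1 : ℕ))))⁻¹ *
      (2 + 4 * (L : ℝ) ^ 2 + (L : ℝ) ^ (d + 1 + 2))⁻¹ := by
    have h8 : (0 : ℝ) < (8 * (d + 1 : ℕ) : ℝ) := by positivity
    have : 0 < W * (1 + ((L : ℝ) ^ (d + 1))⁻¹) + c ^ 2 / (eta L j ^ (d + 1) * ((L : ℝ) ^ j) ^ 2) * (gamma1 (d + 1) * (8 * (d + 1 : ℕ))) :=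
      add_pos_of_nonneg_of_pos (by positivity) (mul_pos hκ (mul_pos hγ1 h8))
    positivity
  exact inverse_entry_decay (QGQs hc Λ' (w := w)) (QGQs_symm hc hjP Λ' hw) hγ₀ hc₀ hδ₀
    (fun x => ineq2147_V1 (P := ⟨d + 1, L, m, K, hd, hL⟩) hc hjP Λ' hw hW0 hW x) (rho_isPseudoDist Λ')
    (fun a ha => by have := latticeConst_nonneg (d + 1) ha.le; positivity) (rho_sumBound Λ' hj) hker (isUnit_QGQs_V1 hc hjP Λ' hw) i i'

include hw in
/-- **(2.148) FOR EVERY COMPRESSION `C_S = ((QGQ*)↾_S)⁻¹` OF `tsV1`** along an injection `e : S ↪ 𝔅` (print's `C_□ = ((QG_□Q*)↾_□)⁻¹`, *"We put B equal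
to 0 outside □"*), from the same displayed kernel bound, SAME constants: `|C_S(y, y′)| ≤ (2/γ₀)·e^{−δ₁ρ(e y, e y′)}`.
[cite: Balaban1984PropagatorsII, (2.143) p.248, (2.148) p.249] -/
theorem ineq2148_V1_submatrix_of_kernel (hj : j + 1 ≤ m + K) {W : ℝ} (hW0 : 0 ≤ W) (hW : ∀ i, w i ≤ W) {c₀ δ₀ : ℝ} (hc₀ : 0 < c₀)
    (hδ₀ : 0 < δ₀)
    (hker : ∀ i i' : CIdx j Λ',
      |⟪EuclideanSpace.single i (1 : ℝ), (tsV1 hc Λ' w).Q ((tsV1 hc Λ' w).G (LinearMap.adjoint (tsV1 hc Λ' w).Q (EuclideanSpace.single i' (1 : ℝ))))⟫_ℝ| ≤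
        c₀ * Real.exp (-(δ₀ * torusSupNorm M₀ (pos₀ i - pos₀ i'))))
    {S : Type*} [Fintype S] [DecidableEq S] {e : S → CIdx j Λ'} (he : Function.Injective e) (y y' : S) :
    |((Matrix.of fun i i' : CIdx j Λ' => (QGQs hc Λ' (w := w)) (EuclideanSpace.single i' (1 : ℝ)) i).submatrix e e)⁻¹ y y'| ≤
      2 / ((W * (1 + ((L : ℝ) ^ (d + 1))⁻¹) + c ^ 2 / (eta L j ^ (d + 1) * ((L : ℝ) ^ j) ^ 2) * (gamma1 (d + 1) * (8 * (d + 1 : ℕ))))⁻¹ *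
          (2 + 4 * (L : ℝ) ^ 2 + (L : ℝ) ^ (d + 1 + 2))⁻¹) *
        Real.exp (-(rate (fun a => 2 * ((d : ℝ) + 1) * latticeConst (d + 1) a)
          (((W * (1 + ((L : ℝ) ^ (d + 1))⁻¹) + c ^ 2 / (eta L j ^ (d + 1) * ((L : ℝ) ^ j) ^ 2) * (gamma1 (d + 1) * (8 * (d + 1 : ℕ))))⁻¹ *
            (2 + 4 * (L : ℝ) ^ 2 + (L : ℝ) ^ (d + 1 + 2))⁻¹) / c₀) 1 δ₀ *
          torusSupNorm M₀ (pos₀ (e y) - pos₀ (e y')))) := by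
  have hjP : j + 1 ≤ (⟨d + 1, L, m, K, hd, hL⟩ : Params).m + (⟨d + 1, L, m, K, hd, hL⟩ : Params).K := hj
  have hκ : 0 < c ^ 2 / (eta L j ^ (d + 1) * ((L : ℝ) ^ j) ^ 2) :=
    B6Ineq2118TwoScaleV1.kappa_pos (P := (⟨d + 1, L, m, K, hd, hL⟩ : Params)) hc (j := j)
  have hγ1 : 0 < gamma1 (d + 1) := Beta.Ineq167OperatorUpper.gamma1_pos (d + 1)
  have hLpos : (0 : ℝ) < L := by exact_mod_cast (lt_trans Nat.zero_lt_one hL.2)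
  have hγ₀ : 0 < (W * (1 + ((L : ℝ) ^ (d + 1))⁻¹) + c ^ 2 / (eta L j ^ (d + 1) * ((L : ℝ) ^ j) ^ 2) * (gamma1 (d + 1) * (8 * (d + 1 : ℕ))))⁻¹ *
      (2 + 4 * (L : ℝ) ^ 2 + (L : ℝ) ^ (d + 1 + 2))⁻¹ := by
    have h8 : (0 : ℝ) < (8 * (d + 1 : ℕ) : ℝ) := by positivity
    have : 0 < W * (1 + ((L : ℝ) ^ (d + 1))⁻¹) + c ^ 2 / (eta L j ^ (d + 1) * ((L : ℝ) ^ j) ^ 2) * (gamma1 (d + 1) * (8 * (d + 1 : ℕ))) :=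
      add_pos_of_nonneg_of_pos (by positivity) (mul_pos hκ (mul_pos hγ1 h8))
    positivity
  exact inverse_submatrix_entry_decay (QGQs hc Λ' (w := w)) (QGQs_symm hc hjP Λ' hw) hγ₀ hc₀ hδ₀
    (fun x => ineq2147_V1 (P := ⟨d + 1, L, m, K, hd, hL⟩) hc hjP Λ' hw hW0 hW x) (rho_isPseudoDist Λ')
    (fun a ha => by have := latticeConst_nonneg (d + 1) ha.le; positivity) (rho_sumBound Λ' hj) hker he y y'

end TwoScale

/-! ## §4  (2.148) UNIFORMLY: one rate `δ₄(d, L, a₀, a₁)` for every volume, `c`, `j`, `Λ′` and all weights of the window -/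

section Uniform

open Classical in
/-- **(2.148) FOR THE GENUINE TWO-SCALE `(QGQ*)⁻¹` OF `tsV1`, UNIFORMLY** (*«This implies the same properties for C^ξ_□ with the corresponding bounds
and a decay rate δ₄»*): for every dimension `d + 1`, odd `L > 1` and `0 < a₀ ≤ a₁` THERE IS `δ₄ > 0` such that for every volume `(m, K)`, every
`c ≠ 0`, every `j + 1 ≤ m + K`, every `Λ′ ⊂ T^{(j+1)}`, all weights `a₀κ ≤ w ≤ a₁κ` (`κ = c²/(η^{d+1}L^{2j})`) and all `i, i′ ∈ 𝔅 = Λ^c ⊔ Λ′`: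
`|⟨e_i, (QGQ*)⁻¹e_{i′}⟩| ≤ (2/γ₀)·e^{−δ₄|p(i) − p(i′)|_T}` with (2.147)'s `γ₀ = (a₁κ(1 + L^{−(d+1)}) + 8(d+1)γ₁κ)⁻¹(2 + 4L² + L^{d+3})⁻¹` (so `2/γ₀ = O(1)·κ`,
print's `(L^jη)^{−d−2}` at the unit normalisation).  The rate: [3] Sect. 5's `rate` at the κ-FREE ratio `γ₀/c₀`, `c₀` the prefactor of
`kernel2147_decay_uniform`. [cite: Balaban1984PropagatorsII, (2.148) p.249] -/
theorem ineq2148_V1_uniform (d L : ℕ) (hd : 1 ≤ d + 1) (hL : Odd L ∧ 1 < L) {a₀ a₁ : ℝ} (ha₀ : 0 < a₀) (ha₁ : a₀ ≤ a₁) :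
    ∃ δ₄ : ℝ, 0 < δ₄ ∧ ∀ (m K : ℕ) (c : ℝ) (hc : c ≠ 0) (j : ℕ) (_hj : j + 1 ≤ m + K)
      (Λ' : Finset (Site (⟨d + 1, L, m, K, hd, hL⟩ : Params) (j + 1))) (w : CIdx j Λ' → ℝ)
      (_hw0 : ∀ i, a₀ * (c ^ 2 / (eta L j ^ (d + 1) * ((L : ℝ) ^ j) ^ 2)) ≤ w i)
      (_hw1 : ∀ i, w i ≤ a₁ * (c ^ 2 / (eta L j ^ (d + 1) * ((L : ℝ) ^ j) ^ 2)))
      (i i' : CIdx j Λ'),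
      |⟪EuclideanSpace.single i (1 : ℝ), Ring.inverse (QGQs hc Λ' (w := w)) (EuclideanSpace.single i' (1 : ℝ))⟫_ℝ| ≤
        2 / ((a₁ * (c ^ 2 / (eta L j ^ (d + 1) * ((L : ℝ) ^ j) ^ 2)) * (1 + ((L : ℝ) ^ (d + 1))⁻¹) +
              c ^ 2 / (eta L j ^ (d + 1) * ((L : ℝ) ^ j) ^ 2) * (gamma1 (d + 1) * (8 * (d + 1 : ℕ))))⁻¹ *
            (2 + 4 * (L : ℝ) ^ 2 + (L : ℝ) ^ (d + 1 + 2))⁻¹) *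
          Real.exp (-(δ₄ * torusSupNorm M₀ (pos₀ i - pos₀ i'))) := by
  obtain ⟨δ, hδ, H⟩ := kernel2147_decay_uniform d L hd hL ha₀ ha₁
  -- the κ-free constants: `Γ⁻¹`, the ratio `r = γ₀/c₀`, the profile `K₂`, the rate `δ₄`
  set Γi : ℝ := (481 * ((d + 1 : ℕ) : ℝ) ^ 6 * (L : ℝ) ^ (2 * (d + 1) + 4))⁻¹ with hΓi
  set g₀ : ℝ := ((a₁ * (1 + ((L : ℝ) ^ (d + 1))⁻¹) + gamma1 (d + 1) * (8 * (d + 1 : ℕ)))⁻¹ *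
    (2 + 4 * (L : ℝ) ^ 2 + (L : ℝ) ^ (d + 1 + 2))⁻¹) with hg₀
  set r : ℝ := g₀ / (2 / (min a₀ 1 * Γi) * Real.exp (2 * δ * (2 * (L : ℝ) - 1))) with hr
  set K₂ : ℝ → ℝ := fun a => 2 * ((d : ℝ) + 1) * latticeConst (d + 1) a with hK₂
  have hLpos : (0 : ℝ) < L := by exact_mod_cast (lt_trans Nat.zero_lt_one hL.2)
  have hγ1 : 0 < gamma1 (d + 1) := Beta.Ineq167OperatorUpper.gamma1_pos (d + 1)
  have ha₁0 : 0 < a₁ := ha₀.trans_le ha₁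
  have hΓ : 0 < Γi := by positivity
  have hg : 0 < g₀ := by positivity
  have hmin : 0 < min a₀ 1 := lt_min ha₀ one_pos
  have hrpos : 0 < r := by positivity
  have hKnn : ∀ a, 0 < a → 0 ≤ K₂ a := fun a ha => by have := latticeConst_nonneg (d + 1) ha.le; positivity
  refine ⟨rate K₂ r 1 δ, rate_pos hKnn hrpos zero_le_one hδ, fun m K c hc j hj Λ' w hw0 hw1 i i' => ?_⟩
  have hjP : j + 1 ≤ (⟨d + 1, L, m, K, hd, hL⟩ : Params).m + (⟨d + 1, L, m, K, hd, hL⟩ : Params).K := hj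
  set κ : ℝ := c ^ 2 / (eta L j ^ (d + 1) * ((L : ℝ) ^ j) ^ 2) with hκdef
  have hκ : 0 < κ := B6Ineq2118TwoScaleV1.kappa_pos (P := (⟨d + 1, L, m, K, hd, hL⟩ : Params)) hc (j := j)
  have hw : ∀ k, 0 < w k := fun k => (mul_pos ha₀ hκ).trans_le (hw0 k)
  -- the instance constants
  set c₀ : ℝ := 2 / (min (a₀ * κ) κ * Γi) * Real.exp (2 * δ * (2 * (L : ℝ) - 1)) with hc₀def
  have hminκ : min (a₀ * κ) κ = min a₀ 1 * κ := by
    rw [min_mul_of_nonneg _ _ hκ.le, one_mul]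
  have hc₀ : 0 < c₀ := by
    have : 0 < min (a₀ * κ) κ := lt_min (mul_pos ha₀ hκ) hκ
    positivity
  set γ₀ : ℝ := (a₁ * κ * (1 + ((L : ℝ) ^ (d + 1))⁻¹) + κ * (gamma1 (d + 1) * (8 * (d + 1 : ℕ))))⁻¹ *
    (2 + 4 * (L : ℝ) ^ 2 + (L : ℝ) ^ (d + 1 + 2))⁻¹ with hγ₀def
  -- `γ₀ = κ⁻¹g₀` and `c₀ = κ⁻¹·(2/(min(a₀,1)Γ⁻¹))e^{2δ(2L−1)}`, so `γ₀/c₀ = r`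
  have hγ₀eq : γ₀ = κ⁻¹ * g₀ := by
    rw [hγ₀def, hg₀]
    have hκ0 : κ ≠ 0 := hκ.ne'
    field_simp
  have hc₀eq : c₀ = κ⁻¹ * (2 / (min a₀ 1 * Γi) * Real.exp (2 * δ * (2 * (L : ℝ) - 1))) := by
    rw [hc₀def, hminκ]
    have hκ0 : κ ≠ 0 := hκ.ne'
    have hm0 : min a₀ 1 ≠ 0 := hmin.ne'
    have hΓ0 : Γi ≠ 0 := hΓ.ne'
    field_simp
  have hratio : γ₀ / c₀ = r := by
    rw [hγ₀eq, hc₀eq, hr, mul_div_mul_left _ _ (inv_ne_zero hκ.ne')]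
  have hmain := ineq2148_V1_of_kernel hc Λ' hw hj (W := a₁ * κ) (by positivity) hw1 hc₀ hδ
    (fun k k' => by rw [pos_eq, pos_eq]; exact H m K c hc j hj Λ' w hw0 hw1 k k') i i'
  rw [hratio] at hmain
  exact hmain

open Classical in
/-- **(2.148) FOR EVERY COMPRESSION `C_S = ((QGQ*)↾_S)⁻¹` OF `tsV1`, UNIFORMLY** (print's `C_□ = ((QG_□Q*)↾_□)⁻¹` for an arbitrary index subset
`S ↪ 𝔅`): with THE SAME `δ₄(d, L, a₀, a₁)` and the same prefactor as `ineq2148_V1_uniform`, for every volume, `c ≠ 0`, `j + 1 ≤ m + K`, `Λ′`, all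
weights of the window, every injection `e : S ↪ 𝔅` and all `y, y′ ∈ S`: `|C_S(y, y′)| ≤ (2/γ₀)·e^{−δ₄|p(e y) − p(e y′)|_T}`.
[cite: Balaban1984PropagatorsII, (2.143) p.248, (2.148) p.249] -/
theorem ineq2148_V1_submatrix_uniform (d L : ℕ) (hd : 1 ≤ d + 1) (hL : Odd L ∧ 1 < L) {a₀ a₁ : ℝ} (ha₀ : 0 < a₀) (ha₁ : a₀ ≤ a₁) :
    ∃ δ₄ : ℝ, 0 < δ₄ ∧ ∀ (m K : ℕ) (c : ℝ) (hc : c ≠ 0) (j : ℕ) (_hj : j + 1 ≤ m + K)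
      (Λ' : Finset (Site (⟨d + 1, L, m, K, hd, hL⟩ : Params) (j + 1))) (w : CIdx j Λ' → ℝ)
      (_hw0 : ∀ i, a₀ * (c ^ 2 / (eta L j ^ (d + 1) * ((L : ℝ) ^ j) ^ 2)) ≤ w i)
      (_hw1 : ∀ i, w i ≤ a₁ * (c ^ 2 / (eta L j ^ (d + 1) * ((L : ℝ) ^ j) ^ 2)))
      (S : Type) [Fintype S] [DecidableEq S] (e : S → CIdx j Λ') (_he : Function.Injective e) (y y' : S),
      |((Matrix.of fun i i' : CIdx j Λ' => (QGQs hc Λ' (w := w)) (EuclideanSpace.single i' (1 : ℝ)) i).submatrix e e)⁻¹ y y'| ≤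
        2 / ((a₁ * (c ^ 2 / (eta L j ^ (d + 1) * ((L : ℝ) ^ j) ^ 2)) * (1 + ((L : ℝ) ^ (d + 1))⁻¹) +
              c ^ 2 / (eta L j ^ (d + 1) * ((L : ℝ) ^ j) ^ 2) * (gamma1 (d + 1) * (8 * (d + 1 : ℕ))))⁻¹ *
            (2 + 4 * (L : ℝ) ^ 2 + (L : ℝ) ^ (d + 1 + 2))⁻¹) *
          Real.exp (-(δ₄ * torusSupNorm M₀ (pos₀ (e y) - pos₀ (e y')))) := by
  obtain ⟨δ, hδ, H⟩ := kernel2147_decay_uniform d L hd hL ha₀ ha₁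
  set Γi : ℝ := (481 * ((d + 1 : ℕ) : ℝ) ^ 6 * (L : ℝ) ^ (2 * (d + 1) + 4))⁻¹ with hΓi
  set g₀ : ℝ := ((a₁ * (1 + ((L : ℝ) ^ (d + 1))⁻¹) + gamma1 (d + 1) * (8 * (d + 1 : ℕ)))⁻¹ *
    (2 + 4 * (L : ℝ) ^ 2 + (L : ℝ) ^ (d + 1 + 2))⁻¹) with hg₀
  set r : ℝ := g₀ / (2 / (min a₀ 1 * Γi) * Real.exp (2 * δ * (2 * (L : ℝ) - 1))) with hr
  set K₂ : ℝ → ℝ := fun a => 2 * ((d : ℝ) + 1) * latticeConst (d + 1) a with hK₂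
  have hLpos : (0 : ℝ) < L := by exact_mod_cast (lt_trans Nat.zero_lt_one hL.2)
  have hγ1 : 0 < gamma1 (d + 1) := Beta.Ineq167OperatorUpper.gamma1_pos (d + 1)
  have ha₁0 : 0 < a₁ := ha₀.trans_le ha₁
  have hΓ : 0 < Γi := by positivity
  have hg : 0 < g₀ := by positivity
  have hmin : 0 < min a₀ 1 := lt_min ha₀ one_pos
  have hrpos : 0 < r := by positivity
  have hKnn : ∀ a, 0 < a → 0 ≤ K₂ a := fun a ha => by have := latticeConst_nonneg (d + 1) ha.le; positivity
  refine ⟨rate K₂ r 1 δ, rate_pos hKnn hrpos zero_le_one hδ, fun m K c hc j hj Λ' w hw0 hw1 S _ _ e he y y' => ?_⟩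
  set κ : ℝ := c ^ 2 / (eta L j ^ (d + 1) * ((L : ℝ) ^ j) ^ 2) with hκdef
  have hκ : 0 < κ := B6Ineq2118TwoScaleV1.kappa_pos (P := (⟨d + 1, L, m, K, hd, hL⟩ : Params)) hc (j := j)
  have hw : ∀ k, 0 < w k := fun k => (mul_pos ha₀ hκ).trans_le (hw0 k)
  set c₀ : ℝ := 2 / (min (a₀ * κ) κ * Γi) * Real.exp (2 * δ * (2 * (L : ℝ) - 1)) with hc₀def
  have hminκ : min (a₀ * κ) κ = min a₀ 1 * κ := by
    rw [min_mul_of_nonneg _ _ hκ.le, one_mul]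
  have hc₀ : 0 < c₀ := by
    have : 0 < min (a₀ * κ) κ := lt_min (mul_pos ha₀ hκ) hκ
    positivity
  set γ₀ : ℝ := (a₁ * κ * (1 + ((L : ℝ) ^ (d + 1))⁻¹) + κ * (gamma1 (d + 1) * (8 * (d + 1 : ℕ))))⁻¹ *
    (2 + 4 * (L : ℝ) ^ 2 + (L : ℝ) ^ (d + 1 + 2))⁻¹ with hγ₀def
  have hγ₀eq : γ₀ = κ⁻¹ * g₀ := by
    rw [hγ₀def, hg₀]
    have hκ0 : κ ≠ 0 := hκ.ne'
    field_simp
  have hc₀eq : c₀ = κ⁻¹ * (2 / (min a₀ 1 * Γi) * Real.exp (2 * δ * (2 * (L : ℝ) - 1))) := by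
    rw [hc₀def, hminκ]
    have hκ0 : κ ≠ 0 := hκ.ne'
    have hm0 : min a₀ 1 ≠ 0 := hmin.ne'
    have hΓ0 : Γi ≠ 0 := hΓ.ne'
    field_simp
  have hratio : γ₀ / c₀ = r := by
    rw [hγ₀eq, hc₀eq, hr, mul_div_mul_left _ _ (inv_ne_zero hκ.ne')]
  have hmain := ineq2148_V1_submatrix_of_kernel hc Λ' hw hj (W := a₁ * κ) (by positivity) hw1 hc₀ hδ
    (fun k k' => by rw [pos_eq, pos_eq]; exact H m K c hc j hj Λ' w hw0 hw1 k k') he y y'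
  rw [hratio] at hmain
  exact hmain

end Uniform


end Literature.MathematicalPhysics.QuantumFieldTheory.Balaban1983to89.B6Ineq2148TwoScaleV1

end
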